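import Summits.CriticalPhenomena.PercolationContinuityZ3.Theorems.PercNearOneGluingNoHeavyLowerTailIncStarBridgeChordThreePoint
import Summits.CriticalPhenomena.PercolationContinuityZ3.Theorems.PercNearOneGluingNoHeavyLowerTailIncStarApexForestSchema
import HarnessLib

/-!
# The increasing star on 'apex + one cycle', given B-cyc (schema)

Support file for the Sahi programme (`--supports stmt-CriticalPhenomena-4575`, prover prim-sahi-p2 gen 20).  No definitions, no named
facts, no sorries; standard axioms.  Memo `run/shared/lean/prim/prim-sahi/prim-sahi-p2/PROOF-E3.md` (30k); lead g120 §9 (CONJECTURE B-cyc: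
on 'apex + cycle' Sahi's cubic of the increasing star is concave along every cycle edge; exact census 0 failures, k ≤ 8).

**Theorem `incStar_nonneg_of_apexUnicyclic_of_cycleChord`.**  If the environment `H(w)` is a forest plus at most one pair, and B-cyc holds in
chord form for every weight of that class (hypothesis `hCyc`), then the increasing star holds for `w`.  Nothing here asserts B-cyc; it is the
hypothesis — the file records that THEOREM B (three-point form), the blob move and B-cyc together settle the unicyclic class, so that with
FC♯ (`…IncStarBlobPairConcave`: cycle regions with at most two exits) the open core is the rim-edge chord of PARTIAL WHEELS with three ports.
-/

noncomputable section

namespace Summit.CriticalPhenomena.PercolationContinuityZ3.Theorems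

namespace IncStar

open MeasureTheory Set Literature.Probability.Percolation Literature.Probability.LatticeModels EdgeInduction
open scoped Classical

variable {n : ℕ}

/-- **STAR ON 'APEX + ONE CYCLE', SCHEMA FORM.**  Let the environment of `w` (non-root pairs of positive weight) be a forest plus at most
one pair (`(H(w) − z₀)` acyclic for some `z₀`).  Assume CONJECTURE B-cyc in chord form (`hCyc`): for every such weight and every positive
environment pair `s(u,v)` lying on a cycle of the environment (`u, v` still joined in `H − s(u,v)`), Sahi's cubic lies above its chord along
`s(u,v)`.  Then `E₃({s↔a},{s↔b},{s↔c}) ≥ 0` for all targets.  Proof: the induction of THEOREM C (`incStar_nonneg_of_apexForest_of_bridgeChord`)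
on the number of fractional non-root pairs, with THEOREM B (`IncStar.incStar_bridge_threePoint`) for 1|2 bridges, the blob move for 0|3
bridges, and `hCyc` for the cycle pairs; every move stays in the class.  With `…IncStarBlobPairConcave` (cycle regions with ≤ 2 exits) this
isolates the THREE-PORT rim-edge chord of partial wheels as the open core of B-cyc (PROOF-E3 (30j)–(30k)). [this work] -/
theorem incStar_nonneg_of_apexUnicyclic_of_cycleChord
    (hCyc : ∀ (w : Sym2 (Fin n) → unitInterval) (z₀ : Sym2 (Fin n)) (s u v a b c : Fin n),
      ((SimpleGraph.fromEdgeSet {z : Sym2 (Fin n) | s ∉ z ∧ w z ≠ 0}).deleteEdges {z₀}).IsAcyclic →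
      u ≠ s → v ≠ s → u ≠ v → w s(u, v) ≠ 0 →
      ((SimpleGraph.fromEdgeSet {z : Sym2 (Fin n) | s ∉ z ∧ w z ≠ 0}).deleteEdges {s(u, v)}).Reachable u v →
      (1 - (w s(u, v) : ℝ)) *
          sahiE3 (prodBernoulli (Function.update w s(u, v) 0)) (openConn s a) (openConn s b) (openConn s c)
        + (w s(u, v) : ℝ) *
          sahiE3 (prodBernoulli (Function.update w s(u, v) 1)) (openConn s a) (openConn s b) (openConn s c)
      ≤ sahiE3 (prodBernoulli w) (openConn s a) (openConn s b) (openConn s c))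
    (w : Sym2 (Fin n) → unitInterval) (s a b c : Fin n) (z₀ : Sym2 (Fin n))
    (hforest : ((SimpleGraph.fromEdgeSet {z : Sym2 (Fin n) | s ∉ z ∧ w z ≠ 0}).deleteEdges {z₀}).IsAcyclic) :
    0 ≤ sahiE3 (prodBernoulli w) (openConn s a) (openConn s b) (openConn s c) := by
  -- THEOREM B (chord form) from its three-point version
  have hB : ∀ (w : Sym2 (Fin n) → unitInterval) (L : Set (Fin n)) (s u v a b c : Fin n),
      s ∉ L → u ∈ L → v ∉ L → a ∈ L → b ∉ L → c ∉ L →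
      (∀ x y : Fin n, x ∈ L → y ∉ L → y ≠ s → s(x, y) ≠ s(u, v) → w s(x, y) = 0) →
      (1 - (w s(u, v) : ℝ)) *
          sahiE3 (prodBernoulli (Function.update w s(u, v) 0)) (openConn s a) (openConn s b) (openConn s c)
        + (w s(u, v) : ℝ) *
          sahiE3 (prodBernoulli (Function.update w s(u, v) 1)) (openConn s a) (openConn s b) (openConn s c)
      ≤ sahiE3 (prodBernoulli w) (openConn s a) (openConn s b) (openConn s c) := by
    intro w L s u v a b c hsL huL hvL haL hbL hcL hcross
    have h := incStar_bridge_threePoint w L hsL huL hvL haL hbL hcL hcross 0 (w s(u, v)) 1 bot_le le_top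
    rw [Function.update_eq_self] at h
    simpa using h
  -- targets at the root are Harris-trivial
  by_cases has : a = s
  · subst has; exact incStar_nonneg_of_target_eq_root w a b c
  by_cases hbs : b = s
  · subst hbs; rw [sahiE3_comm₁₂]; exact incStar_nonneg_of_target_eq_root w b a c
  by_cases hcs : c = s
  · subst hcs; rw [sahiE3_comm₂₃, sahiE3_comm₁₂]; exact incStar_nonneg_of_target_eq_root w c a b
  -- strong induction on the number of fractional non-root off-diagonal pairs, over all targets missing the root
  suffices H : ∀ (N : ℕ) (w : Sym2 (Fin n) → unitInterval) (a b c : Fin n), a ≠ s → b ≠ s → c ≠ s →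
      ((SimpleGraph.fromEdgeSet {z : Sym2 (Fin n) | s ∉ z ∧ w z ≠ 0}).deleteEdges {z₀}).IsAcyclic →
      ((fracEdges w).filter fun z => ¬ z.IsDiag ∧ s ∉ z).card ≤ N →
      0 ≤ sahiE3 (prodBernoulli w) (openConn s a) (openConn s b) (openConn s c) from
    H _ w a b c has hbs hcs hforest le_rfl
  intro N
  induction N with
  | zero =>
    intro w a b c _ _ _ _ hN
    refine incStar_nonneg_of_nonRootDet w s a b c fun z hzd hsz => eq_zero_or_one_of_not_mem_fracEdges fun hz => ?_
    have hmem : z ∈ (fracEdges w).filter (fun z => ¬ z.IsDiag ∧ s ∉ z) := Finset.mem_filter.2 ⟨hz, hzd, hsz⟩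
    have := Finset.card_pos.2 ⟨z, hmem⟩
    omega
  | succ N ih =>
    intro w a b c has hbs hcs hforest hN
    -- subgraphs of the environment stay in the class (same deleted pair `z₀`)
    have del_mono : ∀ {G G' : SimpleGraph (Fin n)}, G ≤ G' → G.deleteEdges {z₀} ≤ G'.deleteEdges {z₀} := by
      intro G G' hle x y hxy
      rw [SimpleGraph.deleteEdges_adj] at hxy ⊢
      exact ⟨hle hxy.1, hxy.2⟩
    by_cases hempty : ((fracEdges w).filter fun z => ¬ z.IsDiag ∧ s ∉ z) = ∅
    · exact ih w a b c has hbs hcs hforest (by rw [hempty, Finset.card_empty]; exact Nat.zero_le _)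
    obtain ⟨z, hz⟩ := Finset.nonempty_iff_ne_empty.2 hempty
    have IH : ∀ (w' : Sym2 (Fin n) → unitInterval),
        ((SimpleGraph.fromEdgeSet {z : Sym2 (Fin n) | s ∉ z ∧ w' z ≠ 0}).deleteEdges {z₀}).IsAcyclic →
        ((fracEdges w').filter fun z => ¬ z.IsDiag ∧ s ∉ z).card < ((fracEdges w).filter fun z => ¬ z.IsDiag ∧ s ∉ z).card →
        0 ≤ sahiE3 (prodBernoulli w') (openConn s a) (openConn s b) (openConn s c) :=
      fun w' hf hlt => ih w' a b c has hbs hcs hf (by omega)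
    -- the chosen fractional environment pair `z = s(u,v)`
    obtain ⟨⟨u, v⟩, rfl⟩ := Quot.exists_rep z
    obtain ⟨hzf, hzd, hzs⟩ := Finset.mem_filter.1 hz
    have huv : u ≠ v := fun h => hzd (Sym2.mk_isDiag_iff.2 h)
    have hus : u ≠ s := fun h => hzs (h ▸ Sym2.mem_mk_left u v)
    have hvs : v ≠ s := fun h => hzs (h ▸ Sym2.mem_mk_right u v)
    have hw0 : w s(u, v) ≠ 0 := by
      intro h
      simp only [fracEdges, Finset.mem_filter, Finset.mem_univ, true_and] at hzf
      rw [h] at hzf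
      simp at hzf
    set H := SimpleGraph.fromEdgeSet {z : Sym2 (Fin n) | s ∉ z ∧ w z ≠ 0} with hH
    -- a cycle pair: the hypothesis `hCyc` gives the chord, and both pinned weights are smaller members of the class
    by_cases hcyc : (H.deleteEdges {s(u, v)}).Reachable u v
    · have h0 : 0 ≤ sahiE3 (prodBernoulli (Function.update w s(u, v) 0)) (openConn s a) (openConn s b) (openConn s c) :=
        IH _ (hforest.anti (del_mono (envGraph_update_le w s _ 0 (Or.inr rfl)))) (fracNR_card_update_lt w s hz 0 (Or.inl rfl))
      have h1 : 0 ≤ sahiE3 (prodBernoulli (Function.update w s(u, v) 1)) (openConn s a) (openConn s b) (openConn s c) :=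
        IH _ (hforest.anti (del_mono (envGraph_update_le w s _ 1 (Or.inl hw0)))) (fracNR_card_update_lt w s hz 1 (Or.inr rfl))
      have hch := hCyc w z₀ s u v a b c hforest hus hvs huv hw0 hcyc
      have hp0 : (0 : ℝ) ≤ w s(u, v) := (w s(u, v)).2.1
      have hp1 : (w s(u, v) : ℝ) ≤ 1 := (w s(u, v)).2.2
      nlinarith [mul_nonneg (sub_nonneg.2 hp1) h0, mul_nonneg hp0 h1]
    have hbridge : ¬ (H.deleteEdges {s(u, v)}).Reachable u v := hcyc
    have hz' : s(v, u) ∈ (fracEdges w).filter (fun z => ¬ z.IsDiag ∧ s ∉ z) := by rw [Sym2.eq_swap]; exact hz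
    have hbridge' : ¬ (H.deleteEdges {s(v, u)}).Reachable v u := by
      rw [Sym2.eq_swap]; exact fun h => hbridge h.symm
    -- the two pinned weights are apex-forests with fewer fractional pairs
    have h0 : 0 ≤ sahiE3 (prodBernoulli (Function.update w s(u, v) 0)) (openConn s a) (openConn s b) (openConn s c) :=
      IH _ (hforest.anti (del_mono (envGraph_update_le w s _ 0 (Or.inr rfl)))) (fracNR_card_update_lt w s hz 0 (Or.inl rfl))
    have h1 : 0 ≤ sahiE3 (prodBernoulli (Function.update w s(u, v) 1)) (openConn s a) (openConn s b) (openConn s c) :=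
      IH _ (hforest.anti (del_mono (envGraph_update_le w s _ 1 (Or.inl hw0)))) (fracNR_card_update_lt w s hz 1 (Or.inr rfl))
    have h0' : 0 ≤ sahiE3 (prodBernoulli (Function.update w s(v, u) 0)) (openConn s a) (openConn s b) (openConn s c) := by
      rw [Sym2.eq_swap]; exact h0
    have h1' : 0 ≤ sahiE3 (prodBernoulli (Function.update w s(v, u) 1)) (openConn s a) (openConn s b) (openConn s c) := by
      rw [Sym2.eq_swap]; exact h1
    -- the component of `u`, and its mirror
    set L : Set (Fin n) := {x | (H.deleteEdges {s(u, v)}).Reachable u x}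
    have hsL : s ∉ L := apexForest_root_not_mem w hus _
    have huL : u ∈ L := SimpleGraph.Reachable.refl u
    have hvL : v ∉ L := hbridge
    have hcross : ∀ x y : Fin n, x ∈ L → y ∉ L → y ≠ s → s(x, y) ≠ s(u, v) → w s(x, y) = 0 :=
      fun x y hx hy hys hne => apexForest_cross w hus {s(u, v)} hx hy hys (by rwa [Set.mem_singleton_iff])
    set M : Set (Fin n) := {x | x ∉ L ∧ x ≠ s}
    have hsM : s ∉ M := fun h => h.2 rfl
    have hvM : v ∈ M := ⟨hvL, hvs⟩
    have huM : u ∉ M := fun h => h.1 huL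
    have hcrossM : ∀ x y : Fin n, x ∈ M → y ∉ M → y ≠ s → s(x, y) ≠ s(v, u) → w s(x, y) = 0 := by
      intro x y hx hy hys hne
      have hyL : y ∈ L := by
        by_contra h
        exact hy ⟨h, hys⟩
      rw [Sym2.eq_swap]
      exact hcross y x hyL hx.1 hx.2 fun h => hne (Sym2.eq_swap.trans (h.trans Sym2.eq_swap))
    have haM : a ∉ L → a ∈ M := fun h => ⟨h, has⟩
    have hbM : b ∉ L → b ∈ M := fun h => ⟨h, hbs⟩
    have hcM : c ∉ L → c ∈ M := fun h => ⟨h, hcs⟩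
    have nM : ∀ {x : Fin n}, x ∈ L → x ∉ M := fun hx h => h.1 hx
    -- eight cases
    by_cases haL : a ∈ L <;> by_cases hbL : b ∈ L <;> by_cases hcL : c ∈ L
    · -- all three near: blob-reduce the component of `v`
      have hfar : ∀ {x : Fin n}, x ∈ L → ¬ (H.deleteEdges {s(v, u)}).Reachable v x := by
        intro x hx h
        rw [Sym2.eq_swap] at h
        exact hbridge (SimpleGraph.Reachable.trans hx h.symm)
      obtain ⟨w', hE, hle, hlt⟩ := apexForest_blob w hvs hus hz' hbridge' (hfar haL) (hfar hbL) (hfar hcL)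
      rw [hE]; exact IH w' (hforest.anti (del_mono hle)) hlt
    · exact apexForest_chord w M hB hsM hvM huM hcrossM (Or.inr (Or.inr ⟨hcM hcL, nM haL, nM hbL⟩)) h0' h1'
    · exact apexForest_chord w M hB hsM hvM huM hcrossM (Or.inr (Or.inl ⟨hbM hbL, nM haL, nM hcL⟩)) h0' h1'
    · exact apexForest_chord w L hB hsL huL hvL hcross (Or.inl ⟨haL, hbL, hcL⟩) h0 h1
    · exact apexForest_chord w M hB hsM hvM huM hcrossM (Or.inl ⟨haM haL, nM hbL, nM hcL⟩) h0' h1'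
    · exact apexForest_chord w L hB hsL huL hvL hcross (Or.inr (Or.inl ⟨hbL, haL, hcL⟩)) h0 h1
    · exact apexForest_chord w L hB hsL huL hvL hcross (Or.inr (Or.inr ⟨hcL, haL, hbL⟩)) h0 h1
    · -- none near: blob-reduce the component of `u`
      obtain ⟨w', hE, hle, hlt⟩ := apexForest_blob w hus hvs hz hbridge haL hbL hcL
      rw [hE]; exact IH w' (hforest.anti (del_mono hle)) hlt

end IncStar

end Summit.CriticalPhenomena.PercolationContinuityZ3.Theorems
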